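import Literature.NumberTheory.LFunctions.WeilExplicitArchTermProofs
import Literature.NumberTheory.LFunctions.WeilArchimedeanPositivityProofs
import Summits.RiemannHypothesis.RiemannHypothesis.Theorems.SpectralTraceWindowTraceArchStubXiAbsorptionAux
import HarnessLib

/-!
# ξ absorbs the Weil distribution on the window — auxiliary file 2: the critical-line integral

Helper file for the stub `stub_xiAbsorption` of the line `causal-level-sets` for the crux
`WindowTraceArch` (stmt-RiemannHypothesis-11195; skeleton
`Summit.RiemannHypothesis.RiemannHypothesis.Cruxes.WindowTraceArch.CausalLevelSets`; the stub is
proved in `Theorems/SpectralTraceWindowTraceArchStubXiAbsorption.lean`).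

For a Weil test `g` supported in `[−log 2, log 2]` and a shift `h > 1/2` we evaluate
`∫ ĝ(1/2 + it) Re(ξ'/ξ)(1/2 + h + it) dt` in `x`-space, in the half-plane of absolute convergence
`Re s = 1/2 + h > 1` (no zeros of `ζ` enter):

* `xiAbs_exists_norm_logDeriv_riemannXi_le` : `|ξ'/ξ(c + iy)| ≤ C(1 + |y|)` on `Re s = c > 1`
  (from `ξ'/ξ = 1/s + 1/(s−1) − (log π)/2 + ½ψ(s/2) − Σ Λ(n)n^{-s}`,
  `logDeriv_riemannXi_eq_of_one_lt_re`, the vertical digamma bound and `Σ Λ(n) n^{-c} < ∞`);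
* `xiAbs_integral_weilMellin_mul_re` : symmetrisation, `∫ ĝ(1/2+iy) Re F(y) dy = ½ ∫ F(y) k̂(1/2+iy) dy`
  for `F(−y) = conj F(y)`, `k = g + g(−·)` (`weilSymm`), since `ĝ(1/2 − iy) = ĝ(1 − (1/2 + iy))`;
* `xiAbs_integral_polar` : `∫ (1/s + 1/(s−1)) k̂(1/2+iy) dy = 2π ∫₀^∞ k(x)(e^{−(h+1/2)x} + e^{(1/2−h)x}) dx`
  (`s = 1/2 + h + iy`; two polar integrals `integral_weilMellin_vertical_div_sub`);
* `xiAbs_integral_LSeries_eq_zero` : `∫ (Σ Λ(n)n^{-s}) k̂(1/2+iy) dy = 0` on the window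
  (`= 2π Σ Λ(n) n^{-h-1/2} k(log n)` and `k(±log n) = 0` for `n ≥ 2`);
* `xiAbs_lhs` (registered sub-goal) :
  `∫ ĝ(1/2+it) Re(ξ'/ξ)(1/2+h+it) dt
    = π ∫₀^∞ k(x)(e^{−(h+1/2)x} + e^{(1/2−h)x}) dx − π log π · g(0) + ¼ ∫ k̂(1/2+iy) ψ((1/2+h+iy)/2) dy`.

Sources: E. Bombieri, Rend. Mat. Acc. Lincei (9) 11 (2000), §2 (2.2)–(2.6) (the right edge of the
explicit-formula contour, here read with the weight on the critical line), as formalised in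
`Literature/NumberTheory/LFunctions/WeilExplicitRightEdge.lean`; all ingredients are proved
tree / Mathlib facts.
-/

set_option linter.dupNamespace false

noncomputable section

open Complex Set MeasureTheory Filter LSeries
open scoped Real Topology ComplexConjugate LSeries.notation ArithmeticFunction.vonMangoldt

namespace Summit.RiemannHypothesis.RiemannHypothesis.Theorems.SpectralTraceWindowTraceArch

open Literature.NumberTheory.LFunctions

variable {g k : ℝ → ℂ} {h : ℝ}

/-! ### `ξ'/ξ` on a line `Re s = c > 1` -/

/-- `|Σ Λ(n) n^{-s}| ≤ Σ Λ(n) n^{-c}` on `Re s = c > 1`. -/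
theorem xiAbs_norm_LSeries_vonMangoldt_le {c : ℝ} (hc : 1 < c) (y : ℝ) :
    ‖L ↗Λ ((c : ℂ) + y * I)‖ ≤ ∑' n : ℕ, ‖term ↗Λ (c : ℂ) n‖ := by
  have hsum : Summable fun n ↦ ‖term ↗Λ ((c : ℂ) + y * I) n‖ := by
    have h := ArithmeticFunction.LSeriesSummable_vonMangoldt (s := (c : ℂ) + y * I)
      (by simp; linarith)
    exact summable_norm_iff.mpr h
  calc ‖L ↗Λ ((c : ℂ) + y * I)‖ = ‖∑' n, term ↗Λ ((c : ℂ) + y * I) n‖ := rfl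
    _ ≤ ∑' n, ‖term ↗Λ ((c : ℂ) + y * I) n‖ := norm_tsum_le_tsum_norm hsum
    _ = ∑' n, ‖term ↗Λ (c : ℂ) n‖ := tsum_congr fun n ↦ norm_term_vertical _ c y n

/-- **`ξ'/ξ` on the line `Re s = c > 1` grows at most linearly**: there is `C` with
`|ξ'/ξ(c + iy)| ≤ C(1 + |y|)` (`1/s`, `1/(s−1)`, `log π` and `Σ Λ(n)n^{-s}` are bounded, `ψ(s/2)`
is `O(log(2 + |y|))`). -/
theorem xiAbs_exists_norm_logDeriv_riemannXi_le {c : ℝ} (hc : 1 < c) :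
    ∃ C : ℝ, ∀ y : ℝ, ‖logDeriv riemannXi ((c : ℂ) + y * I)‖ ≤ C * (1 + |y|) := by
  obtain ⟨Cψ, hψ⟩ :=
    Literature.Analysis.SpecialFunctions.Complex.exists_norm_digamma_vertical_le (a := c / 2)
      (by positivity)
  set M : ℝ := ∑' n : ℕ, ‖term ↗Λ (c : ℂ) n‖ with hM
  have hM0 : 0 ≤ M := tsum_nonneg fun n ↦ norm_nonneg _
  have hc0 : 0 < 1 / c := by positivity
  have hc1 : 0 < 1 / (c - 1) := one_div_pos.2 (by linarith)
  refine ⟨1 / c + 1 / (c - 1) + 1 + |Cψ| + M, fun y ↦ ?_⟩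
  set s : ℂ := (c : ℂ) + y * I with hs
  have hre : 1 < s.re := by simp [hs]; linarith
  rw [logDeriv_riemannXi_eq_of_one_lt_re hre]
  have hsre : s.re = c := by simp [hs]
  have hs1re : (s - 1).re = c - 1 := by simp [hs]
  have h1 : ‖1 / s‖ ≤ 1 / c := by
    rw [norm_div, norm_one]
    have : c ≤ ‖s‖ := by
      have h := Complex.abs_re_le_norm s
      rwa [hsre, abs_of_pos (by linarith : (0 : ℝ) < c)] at h
    exact one_div_le_one_div_of_le (by linarith) this
  have h2 : ‖1 / (s - 1)‖ ≤ 1 / (c - 1) := by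
    rw [norm_div, norm_one]
    have : c - 1 ≤ ‖s - 1‖ := by
      have h := Complex.abs_re_le_norm (s - 1)
      rwa [hs1re, abs_of_pos (by linarith : (0 : ℝ) < c - 1)] at h
    exact one_div_le_one_div_of_le (by linarith) this
  have h3 : ‖-(Real.log π : ℂ) / 2 + 1 / 2 * digamma (s / 2)‖ ≤ 1 + (|Cψ| + |y|) := by
    have hπ : ‖(-(Real.log π : ℂ)) / 2‖ ≤ 1 := by
      rw [norm_div, norm_neg, Complex.norm_real, Real.norm_eq_abs, Complex.norm_two,
        abs_of_pos (Real.log_pos (by linarith [Real.pi_gt_three]))]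
      linarith [log_pi_lt_two]
    have hw : s / 2 = ((c / 2 : ℝ) : ℂ) + (y / 2 : ℝ) * I := by
      simp only [hs]; push_cast; ring
    have hψ' := hψ (y / 2)
    rw [← hw] at hψ'
    have hlog : Real.log (1 + |y / 2|) ≤ |y| := by
      have h0 := log_one_add_abs_le (y / 2)
      rw [abs_div, abs_two] at h0 ⊢
      linarith [abs_nonneg y]
    have hlog0 : 0 ≤ Real.log (1 + |y / 2|) := Real.log_nonneg (by linarith [abs_nonneg (y / 2)])
    calc ‖-(Real.log π : ℂ) / 2 + 1 / 2 * digamma (s / 2)‖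
        ≤ ‖-(Real.log π : ℂ) / 2‖ + ‖(1 / 2 : ℂ) * digamma (s / 2)‖ := norm_add_le _ _
      _ ≤ 1 + 1 / 2 * (Cψ + Real.log (1 + |y / 2|)) := by
          rw [norm_mul]; gcongr; simp
      _ ≤ 1 + (|Cψ| + |y|) := by linarith [le_abs_self Cψ, abs_nonneg Cψ]
  have h4 : ‖L ↗Λ s‖ ≤ M := xiAbs_norm_LSeries_vonMangoldt_le hc y
  have hy0 : 0 ≤ |y| := abs_nonneg y
  calc ‖1 / s + 1 / (s - 1) + (-(Real.log π : ℂ) / 2 + 1 / 2 * digamma (s / 2)) - L ↗Λ s‖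
      ≤ ‖1 / s + 1 / (s - 1) + (-(Real.log π : ℂ) / 2 + 1 / 2 * digamma (s / 2))‖ + ‖L ↗Λ s‖ :=
        norm_sub_le _ _
    _ ≤ ‖1 / s‖ + ‖1 / (s - 1)‖ + ‖-(Real.log π : ℂ) / 2 + 1 / 2 * digamma (s / 2)‖ + ‖L ↗Λ s‖ := by
        gcongr; exact norm_add₃_le
    _ ≤ 1 / c + 1 / (c - 1) + (1 + (|Cψ| + |y|)) + M := by gcongr
    _ ≤ (1 / c + 1 / (c - 1) + 1 + |Cψ| + M) * (1 + |y|) := by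
        nlinarith [abs_nonneg Cψ, mul_nonneg hM0 hy0, mul_nonneg (abs_nonneg Cψ) hy0,
          mul_nonneg hc0.le hy0, mul_nonneg hc1.le hy0]

/-! ### Symmetrisation on the critical line -/

/-- **Symmetrisation.** For a Weil test `g`, `k = g + g(−·)` and a continuous factor `F` of linear
growth with `F(−y) = conj F(y)`:
`∫ ĝ(1/2 + iy) Re F(y) dy = ½ ∫ F(y) k̂(1/2 + iy) dy`
(`Re F = ½(F(y) + F(−y))`, the substitution `y ↦ −y`, and `ĝ(1/2 − iy) = ĝ(1 − (1/2 + iy))`,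
`k̂(s) = ĝ(s) + ĝ(1 − s)`). -/
theorem xiAbs_integral_weilMellin_mul_re (hg : IsWeilTest g) {F : ℝ → ℂ} (hF : Continuous F)
    {C : ℝ} (hC : ∀ y, ‖F y‖ ≤ C * (1 + |y|)) (hconj : ∀ y, F (-y) = conj (F y)) :
    ∫ y : ℝ, weilMellin g (1 / 2 + (y : ℂ) * I) * (((F y).re : ℝ) : ℂ) =
      (1 / 2 : ℂ) * ∫ y : ℝ, F y * weilMellin (weilSymm g) (((1 / 2 : ℝ) : ℂ) + y * I) := by
  have hI1 : Integrable fun y : ℝ ↦ F y * weilMellin g (((1 / 2 : ℝ) : ℂ) + y * I) :=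
    integrable_mul_weilMellin_vertical_of_norm_le_linear hg (1 / 2) hF hC
  have hI2 : Integrable fun y : ℝ ↦ F (-y) * weilMellin g (((1 / 2 : ℝ) : ℂ) + y * I) :=
    integrable_mul_weilMellin_vertical_of_norm_le_linear hg (1 / 2) (hF.comp continuous_neg)
      fun y ↦ by simpa [abs_neg] using hC (-y)
  have hI3 : Integrable fun y : ℝ ↦ F y * weilMellin g (1 - (((1 / 2 : ℝ) : ℂ) + y * I)) := by
    have := integrable_mul_weilMellin_vertical_of_norm_le_linear hg.comp_neg (1 / 2) hF hC
    simpa only [weilMellin_comp_neg] using this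
  have e0 : ∀ y : ℝ, (1 / 2 : ℂ) + (y : ℂ) * I = ((1 / 2 : ℝ) : ℂ) + y * I := by
    intro y; push_cast; ring
  have hre : ∀ y, (((F y).re : ℝ) : ℂ) = (F y + F (-y)) / 2 := by
    intro y
    rw [hconj, Complex.add_conj]
    push_cast
    ring
  have e1 : (fun y : ℝ ↦ weilMellin g (1 / 2 + (y : ℂ) * I) * (((F y).re : ℝ) : ℂ)) =
      fun y : ℝ ↦ (1 / 2 : ℂ) * (F y * weilMellin g (((1 / 2 : ℝ) : ℂ) + y * I) +
        F (-y) * weilMellin g (((1 / 2 : ℝ) : ℂ) + y * I)) := by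
    funext y; rw [hre, e0]; ring
  rw [e1, integral_const_mul, integral_add hI1 hI2]
  congr 1
  have hneg : ∫ y : ℝ, F (-y) * weilMellin g (((1 / 2 : ℝ) : ℂ) + y * I) =
      ∫ y : ℝ, F y * weilMellin g (1 - (((1 / 2 : ℝ) : ℂ) + y * I)) := by
    rw [← integral_neg_eq_self
      (fun y : ℝ ↦ F y * weilMellin g (1 - (((1 / 2 : ℝ) : ℂ) + y * I))) volume]
    congr 1 with y
    congr 2
    push_cast
    ring
  rw [hneg, ← integral_add hI1 hI3]
  congr 1 with y
  rw [weilMellin_weilSymm hg]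
  ring

/-! ### The polar terms -/

/-- **Polar terms on the critical line**: for a Weil test `k` and `h > 1/2`, with
`s = 1/2 + h + iy`,
`∫ (1/s + 1/(s−1)) k̂(1/2 + iy) dy = 2π ∫₀^∞ k(x)(e^{−(h+1/2)x} + e^{(1/2−h)x}) dx`
(`1/s = 1/((1/2+iy) − (−h))`, `1/(s−1) = 1/((1/2+iy) − (1−h))`, both poles to the left of the
line, and `∫ k̂(c+iy)/(c+iy−a) dy = 2π ∫₀^∞ k(x)e^{(a−1/2)x} dx`). -/
theorem xiAbs_integral_polar (hk : IsWeilTest k) (hh : 1 / 2 < h) :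
    ∫ y : ℝ, (1 / ((1 / 2 : ℂ) + h + y * I) + 1 / ((1 / 2 : ℂ) + h + y * I - 1)) *
        weilMellin k (((1 / 2 : ℝ) : ℂ) + y * I) =
      2 * π * ∫ x in Ioi (0 : ℝ), k x *
        (cexp ((-(h : ℂ) - 1 / 2) * x) + cexp ((1 / 2 - (h : ℂ)) * x)) := by
  have hre0 : (-(h : ℂ)).re < (1 / 2 : ℝ) := by simp; linarith
  have hre1 : (1 - (h : ℂ)).re < (1 / 2 : ℝ) := by simp; linarith
  have h0 := integral_weilMellin_vertical_div_sub hk hre0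
  have h1 := integral_weilMellin_vertical_div_sub hk hre1
  have i0 := integrable_weilMellin_vertical_div_sub hk hre0.ne
  have i1 := integrable_weilMellin_vertical_div_sub hk hre1.ne
  have e : (fun y : ℝ ↦ (1 / ((1 / 2 : ℂ) + h + y * I) + 1 / ((1 / 2 : ℂ) + h + y * I - 1)) *
      weilMellin k (((1 / 2 : ℝ) : ℂ) + y * I)) = fun y : ℝ ↦
        weilMellin k (((1 / 2 : ℝ) : ℂ) + y * I) / ((((1 / 2 : ℝ) : ℂ) + y * I) - -(h : ℂ)) +
        weilMellin k (((1 / 2 : ℝ) : ℂ) + y * I) / ((((1 / 2 : ℝ) : ℂ) + y * I) - (1 - (h : ℂ))) := by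
    funext y
    have e1 : (1 / 2 : ℂ) + h + y * I = (((1 / 2 : ℝ) : ℂ) + y * I) - -(h : ℂ) := by
      push_cast; ring
    have e2 : (1 / 2 : ℂ) + h + y * I - 1 = (((1 / 2 : ℝ) : ℂ) + y * I) - (1 - (h : ℂ)) := by
      push_cast; ring
    rw [e2, e1]
    ring
  have hkc : Continuous k := hk.1.continuous
  have j0 : Integrable (fun x : ℝ ↦ k x * cexp ((-(h : ℂ) - 1 / 2) * x))
      (volume.restrict (Ioi 0)) :=
    ((hkc.mul (by fun_prop)).integrable_of_hasCompactSupport hk.2.mul_right).integrableOn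
  have j1 : Integrable (fun x : ℝ ↦ k x * cexp ((1 - (h : ℂ) - 1 / 2) * x))
      (volume.restrict (Ioi 0)) :=
    ((hkc.mul (by fun_prop)).integrable_of_hasCompactSupport hk.2.mul_right).integrableOn
  rw [e, integral_add i0 i1, h0, h1, ← mul_add, ← integral_add j0 j1]
  congr 1
  refine setIntegral_congr_fun measurableSet_Ioi fun x _ ↦ ?_
  have e3 : (1 - (h : ℂ) - 1 / 2) * (x : ℂ) = (1 / 2 - (h : ℂ)) * x := by ring
  rw [e3]
  ring

/-! ### The von Mangoldt terms vanish on the window -/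

/-- **No prime enters below `log 2`.** For a Weil test `g` with `tsupport g ⊆ [−log 2, log 2]`,
`k = g + g(−·)` and `h > 1/2`: `∫ (Σₙ Λ(n) n^{-(1/2+h+iy)}) k̂(1/2 + iy) dy = 0`
(interchange by absolute convergence, `∫ k̂(1/2+iy) n^{-(1/2+iy)} dy = 2π k(log n)/√n`, and
`k(log n) = g(log n) + g(−log n) = 0` for `n ≥ 2`, `Λ(0) = Λ(1) = 0`). -/
theorem xiAbs_integral_LSeries_eq_zero (hg : IsWeilTest g) (hh : 1 / 2 < h)
    (hgs : tsupport g ⊆ Icc (-Real.log 2) (Real.log 2)) :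
    ∫ y : ℝ, L ↗Λ ((1 / 2 : ℂ) + h + y * I) *
        weilMellin (weilSymm g) (((1 / 2 : ℝ) : ℂ) + y * I) = 0 := by
  have hk : IsWeilTest (weilSymm g) := hg.weilSymm
  have es : ∀ y : ℝ, (1 / 2 : ℂ) + h + y * I = ((1 / 2 + h : ℝ) : ℂ) + y * I := by
    intro y; push_cast; ring
  simp_rw [es]
  set c : ℝ := 1 / 2 + h with hc
  have hc1 : 1 < c := by rw [hc]; linarith
  set k := weilSymm g with hk_def
  set F : ℕ → ℝ → ℂ := fun n y ↦ weilMellin k (((1 / 2 : ℝ) : ℂ) + y * I) *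
    term ↗Λ ((c : ℂ) + y * I) n with hF
  have hFint : ∀ n, Integrable (F n) := fun n ↦
    integrable_weilMellin_vertical_mul hk (1 / 2) (continuous_term_vertical _ c n)
      (B := ‖term ↗Λ (c : ℂ) n‖) fun y ↦ (norm_term_vertical _ c y n).le
  have hnorm : ∀ n, (∫ y : ℝ, ‖F n y‖) =
      (∫ y : ℝ, ‖weilMellin k (((1 / 2 : ℝ) : ℂ) + y * I)‖) * ‖term ↗Λ (c : ℂ) n‖ := by
    intro n
    rw [← integral_mul_const]
    congr 1 with y
    rw [hF, norm_mul, norm_term_vertical]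
  have hsum : Summable fun n ↦ ∫ y : ℝ, ‖F n y‖ := by
    simp_rw [hnorm]
    refine Summable.mul_left _ ?_
    have h := ArithmeticFunction.LSeriesSummable_vonMangoldt (s := (c : ℂ)) (by simp; linarith)
    exact summable_norm_iff.mpr h
  have hswap := integral_tsum_of_summable_integral_norm hFint hsum
  have hsupp := support_subset_Ioo_of_tsupport_subset_Icc hg.1.continuous hgs
  have hterm : ∀ n : ℕ, (∫ y : ℝ, F n y) = 0 := by
    intro n
    rcases Nat.lt_or_ge n 2 with hn | hn
    · interval_cases n
      · simp [hF, term_zero]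
      · simp [hF, ArithmeticFunction.vonMangoldt_apply_one]
    · have hn0 : n ≠ 0 := by omega
      have hnC : (n : ℂ) ≠ 0 := Nat.cast_ne_zero.2 hn0
      have e : F n = fun y : ℝ ↦ ((Λ n : ℝ) : ℂ) * (n : ℂ) ^ (-(h : ℂ)) *
          (weilMellin k (((1 / 2 : ℝ) : ℂ) + y * I) *
            (n : ℂ) ^ (-((((1 / 2 : ℝ) : ℂ)) + y * I))) := by
        funext y
        simp only [hF, term_of_ne_zero hn0, div_eq_mul_inv]
        have e1 : ((n : ℂ) ^ ((c : ℂ) + y * I))⁻¹ =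
            (n : ℂ) ^ (-(h : ℂ)) * (n : ℂ) ^ (-((((1 / 2 : ℝ) : ℂ)) + y * I)) := by
          rw [← cpow_neg, ← cpow_add _ _ hnC]
          congr 1
          simp only [hc]
          push_cast
          ring
        rw [e1]
        ring
      rw [e, integral_const_mul, integral_weilMellin_vertical_mul_natCast_cpow hk (1 / 2) hn0]
      have hlog : Real.log 2 ≤ Real.log n := Real.log_le_log two_pos (by exact_mod_cast hn)
      have h1 : g (Real.log n) = 0 := by
        by_contra hne
        have := (hsupp hne).2
        linarith
      have h2 : g (-Real.log n) = 0 := by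
        by_contra hne
        have := (hsupp hne).1
        linarith
      simp [hk_def, weilSymm, h1, h2]
  calc ∫ y : ℝ, L ↗Λ ((c : ℂ) + y * I) * weilMellin k (((1 / 2 : ℝ) : ℂ) + y * I)
      = ∫ y : ℝ, ∑' n : ℕ, F n y := by
        congr 1 with y
        rw [hF, LSeries, mul_comm, ← tsum_mul_left]
    _ = ∑' n : ℕ, ∫ y : ℝ, F n y := hswap.symm
    _ = 0 := by simp [hterm]

/-! ### The critical-line integral -/

/-- **The critical-line integral of `stub_xiAbsorption` in `x`-space** (registered sub-goal): for a
Weil test `g` with `tsupport g ⊆ [−log 2, log 2]`, `k = g + g(−·)` and `h > 1/2`,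
`∫ ĝ(1/2+it) Re(ξ'/ξ)(1/2+h+it) dt
  = π ∫₀^∞ k(x)(e^{−(h+1/2)x} + e^{(1/2−h)x}) dx − π log π · g(0) + ¼ ∫ k̂(1/2+iy) ψ((1/2+iy)/2 + h/2) dy`
(symmetrise; expand `ξ'/ξ(s) = 1/s + 1/(s−1) − (log π)/2 + ½ψ(s/2) − Σ Λ(n)n^{-s}` on
`Re s = 1/2 + h > 1`; the polar, constant and prime pieces are evaluated above, the digamma piece
is kept). -/
theorem xiAbs_lhs :
    ∀ (g : ℝ → ℂ) (h : ℝ), IsWeilTest g → 1 / 2 < h →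
      tsupport g ⊆ Icc (-Real.log 2) (Real.log 2) →
      ∫ t : ℝ, weilMellin g (1 / 2 + (t : ℂ) * I) *
          (((deriv riemannXi (1 / 2 + h + t * I) / riemannXi (1 / 2 + h + t * I)).re : ℝ) : ℂ) =
        π * (∫ x in Ioi (0 : ℝ), weilSymm g x *
            (cexp ((-(h : ℂ) - 1 / 2) * x) + cexp ((1 / 2 - (h : ℂ)) * x)))
          - π * Real.log π * g 0
          + (1 / 4 : ℂ) * ∫ y : ℝ, weilMellin (weilSymm g) (((1 / 2 : ℝ) : ℂ) + y * I) *
              digamma ((((1 / 2 : ℝ) : ℂ) + y * I) / 2 + (h : ℂ) / 2) := by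
  intro g h hg hh hgs
  have hk : IsWeilTest (weilSymm g) := hg.weilSymm
  have hh0 : 0 ≤ h := by linarith
  -- the factor `F(t) = ξ'/ξ(1/2 + h + it)`
  set F : ℝ → ℂ := fun t ↦ logDeriv riemannXi (1 / 2 + h + t * I) with hFdef
  have es : ∀ t : ℝ, (1 / 2 : ℂ) + h + t * I = ((1 / 2 + h : ℝ) : ℂ) + t * I := by
    intro t; push_cast; ring
  have hFc : Continuous F := by
    have hc := continuous_logDeriv_riemannXi_vertical (c := 1 / 2 + h) (by linarith)
    exact hc.congr fun t ↦ by simp only [hFdef, es]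
  obtain ⟨C, hC⟩ := xiAbs_exists_norm_logDeriv_riemannXi_le (c := 1 / 2 + h) (by linarith)
  have hFb : ∀ t, ‖F t‖ ≤ C * (1 + |t|) := fun t ↦ by simp only [hFdef, es]; exact hC t
  have hFconj : ∀ t, F (-t) = conj (F t) := by
    intro t
    simp only [hFdef]
    rw [← logDeriv_riemannXi_conj]
    congr 1
    apply Complex.ext <;> simp
  -- symmetrise
  have eF : (fun t : ℝ ↦ weilMellin g (1 / 2 + (t : ℂ) * I) *
      (((deriv riemannXi (1 / 2 + h + t * I) / riemannXi (1 / 2 + h + t * I)).re : ℝ) : ℂ)) =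
      fun t : ℝ ↦ weilMellin g (1 / 2 + (t : ℂ) * I) * (((F t).re : ℝ) : ℂ) := by
    funext t; simp only [hFdef, logDeriv_apply]
  rw [eF, xiAbs_integral_weilMellin_mul_re hg hFc hFb hFconj]
  -- decompose `F = P + Lπ + G − Z` on `Re s = 1/2 + h > 1`
  set P : ℝ → ℂ := fun y ↦ (1 / ((1 / 2 : ℂ) + h + y * I) + 1 / ((1 / 2 : ℂ) + h + y * I - 1)) *
    weilMellin (weilSymm g) (((1 / 2 : ℝ) : ℂ) + y * I) with hP
  set Lπ : ℝ → ℂ := fun y ↦ (-(Real.log π : ℂ) / 2) *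
    weilMellin (weilSymm g) (((1 / 2 : ℝ) : ℂ) + y * I) with hLπ
  set G : ℝ → ℂ := fun y ↦ 1 / 2 * digamma (((1 / 2 : ℂ) + h + y * I) / 2) *
    weilMellin (weilSymm g) (((1 / 2 : ℝ) : ℂ) + y * I) with hG
  set Z : ℝ → ℂ := fun y ↦ L ↗Λ ((1 / 2 : ℂ) + h + y * I) *
    weilMellin (weilSymm g) (((1 / 2 : ℝ) : ℂ) + y * I) with hZ
  set Φ : ℝ → ℂ := fun y ↦ F y * weilMellin (weilSymm g) (((1 / 2 : ℝ) : ℂ) + y * I) with hΦ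
  have hdecomp : Φ = fun y ↦ P y + Lπ y + G y - Z y := by
    funext y
    simp only [hΦ, hFdef, hP, hLπ, hG, hZ]
    rw [logDeriv_riemannXi_eq_of_one_lt_re (by simp; linarith)]
    ring
  -- integrability
  have hΦi : Integrable Φ :=
    integrable_mul_weilMellin_vertical_of_norm_le_linear hk (1 / 2) hFc hFb
  have hPi : Integrable P := by
    have hre0 : (-(h : ℂ)).re < (1 / 2 : ℝ) := by simp; linarith
    have hre1 : (1 - (h : ℂ)).re < (1 / 2 : ℝ) := by simp; linarith
    have i0 := integrable_weilMellin_vertical_div_sub hk hre0.ne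
    have i1 := integrable_weilMellin_vertical_div_sub hk hre1.ne
    refine (i0.add i1).congr (Eventually.of_forall fun y ↦ ?_)
    have e1 : (1 / 2 : ℂ) + h + y * I = (((1 / 2 : ℝ) : ℂ) + y * I) - -(h : ℂ) := by
      push_cast; ring
    have e2 : (1 / 2 : ℂ) + h + y * I - 1 = (((1 / 2 : ℝ) : ℂ) + y * I) - (1 - (h : ℂ)) := by
      push_cast; ring
    simp only [hP, Pi.add_apply]
    rw [e2, e1]
    ring
  have hLπi : Integrable Lπ := (integrable_weilMellin_vertical hk _).const_mul _
  have ew : ∀ y : ℝ, ((1 / 2 : ℂ) + h + y * I) / 2 =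
      (((1 / 2 : ℝ) : ℂ) + y * I) / 2 + (h : ℂ) / 2 := by
    intro y; push_cast; ring
  have hGi : Integrable G := by
    have := (xiAbs_integrable_weilMellin_mul_digamma hk hh0).const_mul (1 / 2 : ℂ)
    refine this.congr (Eventually.of_forall fun y ↦ ?_)
    simp only [hG]
    rw [ew]
    ring
  have hZi : Integrable Z := by
    have : Z = fun y ↦ P y + Lπ y + G y - Φ y := by
      funext y; rw [hdecomp]; ring
    rw [this]
    exact ((hPi.add hLπi).add hGi).sub hΦi
  -- the four evaluations
  have eP : (∫ y, P y) = 2 * π * ∫ x in Ioi (0 : ℝ), weilSymm g x *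
      (cexp ((-(h : ℂ) - 1 / 2) * x) + cexp ((1 / 2 - (h : ℂ)) * x)) :=
    xiAbs_integral_polar hk hh
  have eL : (∫ y, Lπ y) = -(Real.log π : ℂ) / 2 * (2 * π * (2 * g 0)) :=
    integral_const_mul_weilMellin_weilSymm hg _ (1 / 2)
  have eG : (∫ y, G y) = (1 / 2 : ℂ) * ∫ y : ℝ, weilMellin (weilSymm g) (((1 / 2 : ℝ) : ℂ) + y * I) *
      digamma ((((1 / 2 : ℝ) : ℂ) + y * I) / 2 + (h : ℂ) / 2) := by
    rw [← integral_const_mul]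
    congr 1 with y
    simp only [hG]
    rw [ew]
    ring
  have eZ : (∫ y, Z y) = 0 := xiAbs_integral_LSeries_eq_zero hg hh hgs
  have hPL : Integrable (fun y ↦ P y + Lπ y) := hPi.add hLπi
  have hPLG : Integrable (fun y ↦ P y + Lπ y + G y) := hPL.add hGi
  change (1 / 2 : ℂ) * (∫ y, Φ y) = _
  rw [hdecomp, integral_sub hPLG hZi, integral_add hPL hGi, integral_add hPi hLπi, eP, eL, eG, eZ]
  ring

end Summit.RiemannHypothesis.RiemannHypothesis.Theorems.SpectralTraceWindowTraceArch

end
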